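import Summits.ResolutionOfSingularities.ResolutionOfSingularities.Theorems.PurelyInseparableDim4ResConeCInfLayerPrime
import HarnessLib
import HarnessLib.Audit.Tags

/-!
# Purely inseparable four-folds — the LAYER PERSISTS and «regime R», every prime: after the letter change the flagless light-pair
# power-cone chain never again has a residual monomial of degree `d + 1` (`c ≤ d − 2`), and two steps later every such monomial has both
# slot exponents `≥ 2` (cell `res-dim4-pi`, K2(p) lane, power-cone light-pair line, flagless branch, FILE ♯2b)

[OURS · counted 0 · cell `res-dim4-pi` · K2(p) lane (holder res-dim4-p-12 g5); seat res-dim4-p-3 g6 (MEMO `res-dim4-p-3/MEMO-g6-FLAGLESS-SHARP.md`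
§2 (LAYER), (R)).]  Nothing here proves K2(p) for any `p`, any TAIL(p, p−1, 3), `NoIsolatedTrap p p`, the Cossart–Jannsen–Saito theorem or
resolution of singularities in dimension ≥ 4 / characteristic `p` — NOT proved.  AI kernel work, weaker than expert review.  Exponent algebra.

F-exponents `(e_j, e_i, e_u, e_f)`; `d + 1 = p`; a state is LAYER if it is straight of order `d + 2` with the exact ledger and has NO monomial
of degree `d + 3` with `e_f + 2 ≤ d` (FILE ♯2 `letterChange_layer_prime` produces the first LAYER state at a letter change).
* §1 `three_le_apply_of_layer_step_translate_u` — the `κ`-child (any `β`) of a LAYER state has `e_f + 2 ≤ d ⇒ e_j ≥ 3` (residual `κ`-exponent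
  `≥ 2`: a residual `κ`-exponent `1` needs a degree-`(d+3)` parent); `le_apply_of_step_translate_other` — an `o`-step (any `β′`) keeps every
  lower bound on `e_j` (the `o`-lines freeze `e_j`).  Together («REGIME R»): from two steps after the letter change on, every monomial with
  `e_f + 2 ≤ d` has `e_j ≥ 3 ∧ e_i ≥ 3` as long as LAYER persists.
* §2 **`layer_step_same_prime`** — LAYER parent, `κ`-step (β) in regime, next step AGAIN `κ` (β″) in regime ⇒ the `κ`-child is LAYER: its
  degree-`(d+3)` `κ`-lines have members with `e_j ≥ 3`, so every Hasse sum is a coefficient of the grandchild below degree `d + 3`.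
* §3 **`layer_step_change_prime`** — LAYER parent, `κ`-step (β) in regime, next step `o` (β′) in regime, and the `κ`-child carries NO
  `κ`-KILLER `x_j^{a+1}x_i²x_u^{d−c−a}x_f^c` (`a ≥ 2`, `c + 2 ≤ d`; MEMO (F3): a killer freezes the chart for ever, impossible in an infinite
  chain by the free-tail lemma) ⇒ the `κ`-child is LAYER: the top of each degree-`(d+3)` `o`-line would be such a killer.
[cite: Hauser2010, §§F–G] [cite: CossartJannsenSaito2020, Lemma 13.2, Thm. 3.14]
bears_on: LADDER-RESOLUTION:D157-DOOR2 (res-dim4-pi · K2(p) · power cones · flagless branch ♯2b).  Supports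
stmt-ResolutionOfSingularities-16155 (helper).
-/

set_option linter.dupNamespace false -- mandated namespace of this single-conjunct summit

noncomputable section

namespace Summit.ResolutionOfSingularities.ResolutionOfSingularities.Theorems.PIDim4

namespace ResCone

open MvPolynomial Finset
open Literature.AlgebraicGeometry.Resolution
open Literature.AlgebraicGeometry.Resolution.CentreBlowup
open Literature.AlgebraicGeometry.Resolution.Hauser2010
open Literature.AlgebraicGeometry.Resolution.HauserPerlega2019

variable {K : Type} [Field K] [DecidableEq K]

section Step

variable {j i u f : Fin 4} (hji : j ≠ i) (hju : j ≠ u) (hjf : j ≠ f) (hiu : i ≠ u) (hif : i ≠ f) (huf : u ≠ f)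
include hji hju hjf hiu hif huf

/-! ## 1. Regime R: no residual `κ`-exponent `1` after a `κ`-step from a LAYER state; `o`-steps keep it -/

/-- **After a `κ`-step from a LAYER state every monomial with `e_f + 2 ≤ d` has `e_j ≥ 3`.** [OURS] [cite: Hauser2010, §§F–G] -/
theorem three_le_apply_of_layer_step_translate_u (p : ℕ) {d : ℕ} (hdp : d + 1 = p) (s : State K)
    (hq : ((p : ℕ) : ℕ∞) ≤ ordAlong Finset.univ s.F) (h6 : ∀ e ∈ s.F.support, d + 2 ≤ e.degree)
    (hstraight : ∀ e ∈ s.F.support, e.degree = d + 2 →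
      e = Finsupp.single j 1 + Finsupp.single i 1 + Finsupp.single u 0 + Finsupp.single f d)
    (hlayer : ∀ E : Fin 4 →₀ ℕ, E.degree = d + 3 → E f + 2 ≤ d → coeff E s.F = 0) (β : K) :
    ∀ E ∈ (CentreBlowup.step p Finset.univ j (Function.update (0 : Fin 4 → K) u β) s).F.support, E f + 2 ≤ d → 3 ≤ E j := by
  intro E hE hEf
  obtain ⟨δ, hmem, hm, -, hf, -⟩ := exists_parent_of_mem_support_step_translate_u hji hju hjf hiu hif huf p s hq β hE
  have h6' := h6 δ hmem
  by_contra hlt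
  have hle : δ.degree ≤ d + 3 := by omega
  rcases Nat.eq_or_lt_of_le h6' with heq | hgt
  · have hc := hstraight δ hmem heq.symm
    have := (quad_apply hji hju hjf hiu hif huf 1 1 0 d).2.2.2
    rw [← hc, hf] at this
    omega
  · exact mem_support_iff.mp hmem (hlayer δ (by omega) (by rw [hf]; exact hEf))

/-- **An `o`-step keeps lower bounds on `e_j`**: if every parent monomial with `e_f + 2 ≤ d` has `n ≤ e_j`, so does every monomial of the
slot step in the chart of the other slot `i` translated by any `β′·e_u` (its lines freeze `e_j`). [OURS] [folklore] -/
theorem le_apply_of_step_translate_other (p : ℕ) {d n : ℕ} (s : State K) (hq : ((p : ℕ) : ℕ∞) ≤ ordAlong Finset.univ s.F)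
    (hn : ∀ E ∈ s.F.support, E f + 2 ≤ d → n ≤ E j) (β' : K) :
    ∀ E ∈ (CentreBlowup.step p Finset.univ i (Function.update (0 : Fin 4 → K) u β') s).F.support, E f + 2 ≤ d → n ≤ E j := by
  intro E hE hEf
  obtain ⟨δ, hmem, -, hj, hf, -⟩ := exists_parent_of_mem_support_step_translate_u hji.symm hiu hif hju hjf huf p s hq β' hE
  rw [← hj]
  exact hn δ hmem (by rw [hf]; exact hEf)

/-! ## 2. LAYER persists through a `κ`-step followed by another `κ`-step -/

/-- **LAYER PERSISTS, same letter** (`d + 1 = p`, `2 ≤ d`): LAYER parent `s`; `s₁` = `κ`-step (β) in regime; `s₂` = `κ`-step (β″) of `s₁`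
in regime.  Then `s₁` has no monomial of degree `d + 3` with `e_f + 2 ≤ d`. [OURS] [cite: Hauser2010, §§F–G] -/
theorem layer_step_same_prime (p : ℕ) [hp : Fact p.Prime] {d : ℕ} (hdp : d + 1 = p) (hd2 : 2 ≤ d) (s : State K)
    (hq : ((p : ℕ) : ℕ∞) ≤ ordAlong Finset.univ s.F) (h6 : ∀ e ∈ s.F.support, d + 2 ≤ e.degree)
    (hstraight : ∀ e ∈ s.F.support, e.degree = d + 2 →
      e = Finsupp.single j 1 + Finsupp.single i 1 + Finsupp.single u 0 + Finsupp.single f d)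
    (hlayer : ∀ E : Fin 4 →₀ ℕ, E.degree = d + 3 → E f + 2 ≤ d → coeff E s.F = 0) (β β'' : K)
    (hq₁ : ((p : ℕ) : ℕ∞) ≤ ordAlong Finset.univ (CentreBlowup.step p Finset.univ j (Function.update (0 : Fin 4 → K) u β) s).F)
    (hreg₂ : ∀ E ∈ (CentreBlowup.step p Finset.univ j (Function.update (0 : Fin 4 → K) u β'')
        (CentreBlowup.step p Finset.univ j (Function.update (0 : Fin 4 → K) u β) s)).F.support,
      d + 3 ≤ E.degree ∨ E = Finsupp.single j 1 + Finsupp.single i 1 + Finsupp.single u 0 + Finsupp.single f d) :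
    ∀ E : Fin 4 →₀ ℕ, E.degree = d + 3 → E f + 2 ≤ d →
      coeff E (CentreBlowup.step p Finset.univ j (Function.update (0 : Fin 4 → K) u β) s).F = 0 := by
  classical
  set s₁ := CentreBlowup.step p Finset.univ j (Function.update (0 : Fin 4 → K) u β) s with hs₁
  have hp3 : 3 ≤ p := by have := hp.out.two_le; omega
  have h3 := three_le_apply_of_layer_step_translate_u hji hju hjf hiu hif huf p hdp s hq h6 hstraight hlayer β
  intro E hEdeg hEf
  by_contra hne
  have hmem : E ∈ s₁.F.support := mem_support_iff.mpr hne
  have hEj : 3 ≤ E j := h3 E hmem hEf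
  have hEquad := degree_eq_quad hji hju hjf hiu hif huf E
  -- the `κ`-line of `E` in `s₁`: members have `e_j ≥ 3`, so `e_u ≤ d − E_i − E_f`
  have htop : ∀ δ ∈ s₁.F.support, δ.degree = d + 3 → δ i = E i → δ f = E f → δ u ≤ d - E i - E f := by
    intro δ hδ hm hi' hf'
    have := h3 δ hδ (by omega)
    have := degree_eq_quad hji hju hjf hiu hif huf δ
    omega
  have hvan : ∀ J, J ≤ d - E i - E f →
      ∑ δ ∈ s₁.F.support with (δ.degree = d + 3 ∧ δ i = E i ∧ δ f = E f),
        ((δ u).choose J : K) * β'' ^ (δ u - J) * coeff δ s₁.F = 0 := by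
    intro J hJ
    set γ : Fin 4 →₀ ℕ := Finsupp.single i (E i) + Finsupp.single u J + Finsupp.single f (E f) with hγ
    have hγj : γ j = 0 := by
      rw [hγ, Finsupp.add_apply, Finsupp.add_apply, Finsupp.single_eq_of_ne hji, Finsupp.single_eq_of_ne hju,
        Finsupp.single_eq_of_ne hjf]; simp
    have hγi : γ i = E i := by
      rw [hγ, Finsupp.add_apply, Finsupp.add_apply, Finsupp.single_eq_same, Finsupp.single_eq_of_ne hiu,
        Finsupp.single_eq_of_ne hif]; simp
    have hγu : γ u = J := by
      rw [hγ, Finsupp.add_apply, Finsupp.add_apply, Finsupp.single_eq_of_ne hiu.symm, Finsupp.single_eq_same,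
        Finsupp.single_eq_of_ne huf]; simp
    have hγf : γ f = E f := by
      rw [hγ, Finsupp.add_apply, Finsupp.add_apply, Finsupp.single_eq_of_ne hif.symm, Finsupp.single_eq_of_ne huf.symm,
        Finsupp.single_eq_same]; simp
    have hnp : ¬ IsPthPowerExponent p (γ + Finsupp.single j (d + 3 - p)) := by
      rw [isPthPowerExponent_iff]
      intro h
      have h2 := h j
      rw [Finsupp.add_apply, hγj, zero_add, Finsupp.single_eq_same, show d + 3 - p = 2 by omega] at h2
      have := Nat.le_of_dvd (by norm_num) h2
      omega
    have key := coeff_step_translate_u hji hju hjf hiu hif huf p s₁ hq₁ β'' (show p ≤ d + 3 by omega) γ hγj hnp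
    simp only [hγi, hγu, hγf] at key
    rw [← key]
    refine notMem_support_iff.mp fun hmem₂ => ?_
    rcases hreg₂ _ hmem₂ with hge | hcone
    · have hdegγ : (γ + Finsupp.single j (d + 3 - p)).degree = E i + J + E f + (d + 3 - p) := by
        rw [map_add, Finsupp.degree_single, hγ, map_add, map_add, Finsupp.degree_single, Finsupp.degree_single,
          Finsupp.degree_single]
      have := htop E hmem hEdeg rfl rfl
      rw [hdegγ] at hge
      omega
    · have hj2 : (γ + Finsupp.single j (d + 3 - p)) j =
          (Finsupp.single j 1 + Finsupp.single i 1 + Finsupp.single u 0 + Finsupp.single f d : Fin 4 →₀ ℕ) j := by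
        rw [hcone]
      rw [Finsupp.add_apply, hγj, Finsupp.single_eq_same, (quad_apply hji hju hjf hiu hif huf 1 1 0 d).1] at hj2
      omega
  exact hne (line_eq_zero_of_hasse_vanish hji hju hjf hiu hif huf s₁.F (d + 3) (E i) (E f) β'' (d - E i - E f) htop hvan E
    hEdeg rfl rfl)

/-! ## 3. LAYER persists through a `κ`-step followed by an `o`-step, if the child carries no `κ`-killer -/

/-- **LAYER PERSISTS, letter change, no killer** (`d + 1 = p`, `2 ≤ d`): LAYER parent `s`; `s₁` = `κ`-step (β) in regime carrying NO
`κ`-killer (`coeff x_j^{a}x_i²x_u^{d+1−c−a}x_f^c s₁.F = 0` for `3 ≤ a`, `c + 2 ≤ d` — F-exponents of MEMO's `BX(c)`); `s₂` = `o`-step (β′) of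
`s₁` in regime.  Then `s₁` has no monomial of degree `d + 3` with `e_f + 2 ≤ d`. [OURS] [cite: Hauser2010, §§F–G] -/
theorem layer_step_change_prime (p : ℕ) [hp : Fact p.Prime] {d : ℕ} (hdp : d + 1 = p) (hd2 : 2 ≤ d) (s : State K)
    (hq : ((p : ℕ) : ℕ∞) ≤ ordAlong Finset.univ s.F) (h6 : ∀ e ∈ s.F.support, d + 2 ≤ e.degree)
    (hstraight : ∀ e ∈ s.F.support, e.degree = d + 2 →
      e = Finsupp.single j 1 + Finsupp.single i 1 + Finsupp.single u 0 + Finsupp.single f d)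
    (hled : ∀ e ∈ s.F.support, e f ≤ d - 1 → 2 ≤ e j ∧ 2 ≤ e i)
    (hlayer : ∀ E : Fin 4 →₀ ℕ, E.degree = d + 3 → E f + 2 ≤ d → coeff E s.F = 0) (β β' : K)
    (hq₁ : ((p : ℕ) : ℕ∞) ≤ ordAlong Finset.univ (CentreBlowup.step p Finset.univ j (Function.update (0 : Fin 4 → K) u β) s).F)
    (hnokill : ∀ a c : ℕ, 3 ≤ a → c + 2 ≤ d → a ≤ d + 1 - c →
      coeff (Finsupp.single j a + Finsupp.single i 2 + Finsupp.single u (d + 1 - c - a) + Finsupp.single f c)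
        (CentreBlowup.step p Finset.univ j (Function.update (0 : Fin 4 → K) u β) s).F = 0)
    (hreg₂ : ∀ E ∈ (CentreBlowup.step p Finset.univ i (Function.update (0 : Fin 4 → K) u β')
        (CentreBlowup.step p Finset.univ j (Function.update (0 : Fin 4 → K) u β) s)).F.support,
      d + 3 ≤ E.degree ∨ E = Finsupp.single j 1 + Finsupp.single i 1 + Finsupp.single u 0 + Finsupp.single f d) :
    ∀ E : Fin 4 →₀ ℕ, E.degree = d + 3 → E f + 2 ≤ d →
      coeff E (CentreBlowup.step p Finset.univ j (Function.update (0 : Fin 4 → K) u β) s).F = 0 := by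
  classical
  set s₁ := CentreBlowup.step p Finset.univ j (Function.update (0 : Fin 4 → K) u β) s with hs₁
  have hp3 : 3 ≤ p := by have := hp.out.two_le; omega
  have h3 := three_le_apply_of_layer_step_translate_u hji hju hjf hiu hif huf p hdp s hq h6 hstraight hlayer β
  obtain ⟨hled₁, -⟩ := ledger_step_translate_u hji hju hjf hiu hif huf p hdp hd2 s hq h6 hstraight hled β
  intro E hEdeg hEf
  by_contra hne
  have hmem : E ∈ s₁.F.support := mem_support_iff.mpr hne
  have hEj : 3 ≤ E j := h3 E hmem hEf
  have hEquad := degree_eq_quad hji hju hjf hiu hif huf E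
  have hEi : 2 ≤ E i := (hled₁ E hmem (by omega)).2
  -- if `E_i = 2` then `E` itself is a `κ`-killer position: absent by hypothesis
  rcases Nat.eq_or_lt_of_le hEi with hEi2 | hEi3
  · apply hne
    have hEu : E u = d + 1 - E f - E j := by omega
    rw [eq_sum_single_four hji hju hjf hiu hif huf E, ← hEi2, hEu]
    exact hnokill (E j) (E f) hEj hEf (by omega)
  -- the `o`-line of `E` in `s₁`: members in the support have `e_i ≥ 3` (the member with `e_i = 2` is the κ-killer, absent)
  have htop : ∀ δ ∈ s₁.F.support, δ.degree = d + 3 → δ j = E j → δ f = E f → δ u ≤ d - E j - E f := by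
    intro δ hδ hm hj' hf'
    have h2 := (hled₁ δ hδ (by omega)).2
    have hdq := degree_eq_quad hji hju hjf hiu hif huf δ
    by_contra hgt
    have hδi : δ i = 2 := by omega
    have hδu : δ u = d + 1 - E f - E j := by omega
    apply mem_support_iff.mp hδ
    rw [eq_sum_single_four hji hju hjf hiu hif huf δ, hj', hδi, hδu, hf']
    exact hnokill (E j) (E f) hEj hEf (by omega)
  have hvan : ∀ J, J ≤ d - E j - E f →
      ∑ δ ∈ s₁.F.support with (δ.degree = d + 3 ∧ δ j = E j ∧ δ f = E f),
        ((δ u).choose J : K) * β' ^ (δ u - J) * coeff δ s₁.F = 0 := by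
    intro J hJ
    set γ' : Fin 4 →₀ ℕ := Finsupp.single j (E j) + Finsupp.single u J + Finsupp.single f (E f) with hγ'
    have hγ'i : γ' i = 0 := by
      rw [hγ', Finsupp.add_apply, Finsupp.add_apply, Finsupp.single_eq_of_ne hji.symm, Finsupp.single_eq_of_ne hiu,
        Finsupp.single_eq_of_ne hif]; simp
    have hγ'j : γ' j = E j := by
      rw [hγ', Finsupp.add_apply, Finsupp.add_apply, Finsupp.single_eq_same, Finsupp.single_eq_of_ne hju,
        Finsupp.single_eq_of_ne hjf]; simp
    have hγ'u : γ' u = J := by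
      rw [hγ', Finsupp.add_apply, Finsupp.add_apply, Finsupp.single_eq_of_ne hju.symm, Finsupp.single_eq_same,
        Finsupp.single_eq_of_ne huf]; simp
    have hγ'f : γ' f = E f := by
      rw [hγ', Finsupp.add_apply, Finsupp.add_apply, Finsupp.single_eq_of_ne hjf.symm, Finsupp.single_eq_of_ne huf.symm,
        Finsupp.single_eq_same]; simp
    have hnp : ¬ IsPthPowerExponent p (γ' + Finsupp.single i (d + 3 - p)) := by
      rw [isPthPowerExponent_iff]
      intro h
      have h2 := h i
      rw [Finsupp.add_apply, hγ'i, zero_add, Finsupp.single_eq_same, show d + 3 - p = 2 by omega] at h2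
      have := Nat.le_of_dvd (by norm_num) h2
      omega
    have key := coeff_step_translate_u hji.symm hiu hif hju hjf huf p s₁ hq₁ β' (show p ≤ d + 3 by omega) γ' hγ'i hnp
    simp only [hγ'j, hγ'u, hγ'f] at key
    rw [← key]
    refine notMem_support_iff.mp fun hmem₂ => ?_
    rcases hreg₂ _ hmem₂ with hge | hcone
    · have hdegγ : (γ' + Finsupp.single i (d + 3 - p)).degree = E j + J + E f + (d + 3 - p) := by
        rw [map_add, Finsupp.degree_single, hγ', map_add, map_add, Finsupp.degree_single, Finsupp.degree_single,
          Finsupp.degree_single]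
      rw [hdegγ] at hge
      omega
    · have hi2 : (γ' + Finsupp.single i (d + 3 - p)) i =
          (Finsupp.single j 1 + Finsupp.single i 1 + Finsupp.single u 0 + Finsupp.single f d : Fin 4 →₀ ℕ) i := by
        rw [hcone]
      rw [Finsupp.add_apply, hγ'i, Finsupp.single_eq_same, (quad_apply hji hju hjf hiu hif huf 1 1 0 d).2.1] at hi2
      omega
  exact hne (line_eq_zero_of_hasse_vanish hji.symm hiu hif hju hjf huf s₁.F (d + 3) (E j) (E f) β' (d - E j - E f) htop hvan E
    hEdeg rfl rfl)

end Step

end ResCone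

end Summit.ResolutionOfSingularities.ResolutionOfSingularities.Theorems.PIDim4
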